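import Summits.MatrixMultiplication.MatrixMultiplication.Theorems.AbelianSTPPCensusLeafTE337Closed

/-!
# Rung leaves closed as corollaries of T_E/337: T_E/110, T_D/300, T_C/300, T_B/300, T_A/300

Cell mm-stpp, rung F-M1 (D-0059/D-0061, ALT-CLOSER list 4).  The registered leaves
`NoAbelianSTPPHost_250_110`, `NoAbelianSTPPHost_247_300`, `NoAbelianSTPPHost_240_300`,
`NoAbelianSTPPHost_2375_300`, `NoAbelianSTPPHost_2371_300` (`AbelianSTPPCensusTargets.lean`) all follow from the
landed leaf T_E/337 `noAbelianSTPPHost_250_337` (route `AbelianSTPPCensusVP`, p448915) by two monotonicities of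
`NoAbelianSTPPHostUpTo τ M`: in the range `M` (tree, `noAbelianSTPPHostUpTo_mono`) and in the exponent `τ`
(`noAbelianSTPPHostUpTo_anti`, here): for `0 < τ ≤ τ'` every volume term satisfies `V^{τ/3} ≤ V^{τ'/3}`
(`V ≥ 1`, and a zero volume contributes `0` on both sides), so a family that does not beat `τ'` does not beat `τ`.

WHAT THIS IS NOT: no bound on `ω`; rung leaves (class «rung leaf», never summit credit); nothing about orders
`> 337`; T_A/450 (`NoAbelianSTPPHost_2371_450`) is NOT among these corollaries (orders 338–450 need a certificate).
-/

set_option linter.dupNamespace false -- `MatrixMultiplication.MatrixMultiplication` (summit = problem, D-0017)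

namespace Summit.MatrixMultiplication.MatrixMultiplication.Theorems

open Finset Literature.Computability.AlgebraicComplexity

/-- **Monotonicity in the exponent.** For `0 < τ ≤ τ'`, a range bound at exponent `τ'` implies the range bound at
exponent `τ`: term by term `(V : ℝ)^{τ/3} ≤ (V : ℝ)^{τ'/3}` for a natural number `V` (`V = 0`: both sides vanish;
`V ≥ 1`: `Real.rpow` is monotone in the exponent on `[1, ∞)`). [bookkeeping] -/
theorem noAbelianSTPPHostUpTo_anti {τ τ' : ℝ} (hτ : 0 < τ) (hle : τ ≤ τ') {M : ℕ} :
    NoAbelianSTPPHostUpTo τ' M → NoAbelianSTPPHostUpTo τ M := by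
  intro h H _ _ hM N A B C hS
  refine le_trans (Finset.sum_le_sum fun i _ => ?_) (h H hM N A B C hS)
  rcases Nat.eq_zero_or_pos ((A i).card * (B i).card * (C i).card) with h0 | hpos
  · have hτ3 : τ / 3 ≠ 0 := by positivity
    have hτ3' : τ' / 3 ≠ 0 := by
      have : 0 < τ' := lt_of_lt_of_le hτ hle
      positivity
    rw [h0, Nat.cast_zero, Real.zero_rpow hτ3, Real.zero_rpow hτ3']
  · exact Real.rpow_le_rpow_of_exponent_le (by exact_mod_cast hpos) (by linarith)

/-- **Rung leaf T_E/110 (closed).** No abelian STPP host of order `≤ 110` beats exponent `5/2`. [original] -/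
theorem noAbelianSTPPHost_250_110 : NoAbelianSTPPHost_250_110 :=
  noAbelianSTPPHostUpTo_mono (by norm_num) noAbelianSTPPHost_250_337

/-- **Rung leaf T_D/300 (closed).** No abelian STPP host of order `≤ 300` beats exponent `2.47`:
`Σ_i (|A_i||B_i||C_i|)^{2.47/3} ≤ |H|` for every STPP family in every finite abelian group of order `≤ 300`.
[original] -/
theorem noAbelianSTPPHost_247_300 : NoAbelianSTPPHost_247_300 :=
  noAbelianSTPPHostUpTo_anti (by norm_num) (by norm_num)
    (noAbelianSTPPHostUpTo_mono (by norm_num) noAbelianSTPPHost_250_337)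

/-- **Rung leaf T_C/300 (closed).** No abelian STPP host of order `≤ 300` beats exponent `2.4`. [original] -/
theorem noAbelianSTPPHost_240_300 : NoAbelianSTPPHost_240_300 :=
  noAbelianSTPPHostUpTo_anti (by norm_num) (by norm_num)
    (noAbelianSTPPHostUpTo_mono (by norm_num) noAbelianSTPPHost_250_337)

/-- **Rung leaf T_B/300 (closed).** No abelian STPP host of order `≤ 300` beats exponent `2.375`. [original] -/
theorem noAbelianSTPPHost_2375_300 : NoAbelianSTPPHost_2375_300 :=
  noAbelianSTPPHostUpTo_anti (by norm_num) (by norm_num)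
    (noAbelianSTPPHostUpTo_mono (by norm_num) noAbelianSTPPHost_250_337)

/-- **Rung leaf T_A/300 (closed).** No abelian STPP host of order `≤ 300` beats the (rounded) record exponent
`2.371`: no STPP family in a finite abelian group of order `≤ 300` certifies `ω < 2.371` through the CKSU packing
bound. [original] -/
theorem noAbelianSTPPHost_2371_300 : NoAbelianSTPPHost_2371_300 :=
  noAbelianSTPPHostUpTo_anti (by norm_num) (by norm_num)
    (noAbelianSTPPHostUpTo_mono (by norm_num) noAbelianSTPPHost_250_337)

/-- T_A up to the T_E ceiling: no abelian STPP host of order `≤ 337` beats exponent `2.371` (the half of the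
registered leaf T_A/450 that T_E/337 already covers). [original] -/
theorem noAbelianSTPPHostUpTo_2371_337 : NoAbelianSTPPHostUpTo (2371 / 1000) 337 :=
  noAbelianSTPPHostUpTo_anti (by norm_num) (by norm_num) noAbelianSTPPHost_250_337

end Summit.MatrixMultiplication.MatrixMultiplication.Theorems
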